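import Literature.MathematicalPhysics.QuantumFieldTheory.Balaban1983to89.B6Prop26PrintedKLevelV1
import Literature.MathematicalPhysics.QuantumFieldTheory.Balaban1983to89.B6Prop26DivLegKLevelV1
import Literature.MathematicalPhysics.QuantumFieldTheory.Balaban1983to89.B6Cor28HolderUnifKLevelV1
import HarnessLib

/-!
# `Balaban1983to89.B6Prop26PrintedStage2KLevelV1` — T. Bałaban, *Propagators and renormalization transformations for lattice gauge theories. II*,
Comm. Math. Phys. **96** (1984) 223–250 [Balaban1984PropagatorsII], **Proposition 2.6 (2.136)–(2.141) p. 247: THE VERBATIM CENSUS TYPING `B6.Prop26Printed`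
ON THE GENUINE k-LEVEL V1 FAMILY WITH THE SLOTS h3 ((2.136)₃) AND hm1 (the (2.137)₁ pair majorant) DISCHARGED BY NAME** (B6-CLOSURE §5 item 22, STAGE 2 of the
census assembly — further stages discharge hm2 / hl4 / hl5 / c3 / c4 as their producers land; owner r03): `B6Prop26PrintedKLevelV1.prop26Printed_kLevel_of_slots` (✓ p391129) fed with
* h3 := p38's `B6Prop26DivLegKLevelV1.prop26_2136_div_kLevel_census` (✓ p391967: (2.136)₃ `|(G∇*J)(x)|` at k levels for the genuine `G`, hypothesis-free,
  in the census2136 slot shape verbatim) — which also feeds the (2.140)₂,₃ slots inside `prop26Printed_kLevel_of_slots` (p22's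
  `ineq2140_grad(T)_kLevel_census_of_h3`);
* hm1 := `hm1_of_unif` — the census2137 slot hm1 (the (2.137)₁ pair majorant of `P_{x,x′}·∇_νG`, one threshold before the Hölder exponent) read off
  r03's `B6Cor28HolderUnifKLevelV1.ineq2137_grad_kLevel_unif` (p22's `holderLegs_kLevel` ✓ p391980 + `prop26_2137_grad_kLevel_of_legs` ✓ p374136) at
  `σ := σ₁`, `β := ½` (`δ := delta3 ½ (2σ₁)`; the census binder `N₁ + 1 ≤ R·L·M_h` is not needed and ignored).

Displayed slot inputs REMAINING in `prop26Printed_kLevel_of_slots5`: hm2 (the (2.137) pair majorant of `G∇*_ν` — p38's brick 7), hl3 ((2.140)₄ `∇G∇*`,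
unowned, GAPS G-B6-2140-456), hl4/hl5 ((2.140)₅,₆ — p22's FILE L `B6Ineq2140Grad2KLevelV1`), c3/c4 ((2.138)/(2.139) — p27's lane), each in the shape of
`B6Prop26PrintedKLevelV1` verbatim.

HONEST FRAMING (programme rule): statement-level skeleton of published theorems with citation tags; proofs where landed; nothing here
is a claim about the Yang–Mills mass gap.

HONEST SCOPE: as in `B6Prop26PrintedKLevelV1` (census on the V1 torus family of ROUTE V/W, `k ≥ 2`; `suppIn` = unit cube Δ(y′), the sub-case of print's
Δ̃(y′) for (2.138)/(2.139) — GAPS G-B6-2138-SUPP; constants ours on `d, L, b₀, b₁`).  THEOREMS ONLY; no `def … : Prop`.  NOT summit progress.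
Unit `lit-balaban-r03` (gen 26), 2026-08-25.
-/

namespace Literature.MathematicalPhysics.QuantumFieldTheory.Balaban1983to89.B6Prop26PrintedStage2KLevelV1

open LatticeFieldCalculus
open B6SectAOperatorsV1 (BondIdx)
open B6SectAVectorModelV1 (GE)
open B6Ineq2133TwoScaleV1 (onFun)
open B6RandomWalk (HasMajorant delta3 delta3_pos)
open B6MultiLevelBoxOperator (N0)
open B6MultiLevelTorusOperator (TDomains)
open B6GlobalChartV1 (PV domT blkV1)
open B6Geom246MultiLevelTorus (geomT)
open B6Prop26KLevelAssemblyV1 (distT_nonneg)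
open B6CubeWindowV1 (Placed GlobalBand)
open B6Cover236MultiLevelBlocks (cubes)
open B6GradLegKLevelV1 (DV)
open B6LapLegKLevelV1 (DVa)
open B6HolderPairMemberV1 (pairOp)
open B6KLevelCensusIndexV1 (KIdx Adm tpar kGeoG lenG_pos supNormG_nonneg tpar_nonneg)
open B6Prop26Census2136KLevelV1 (kG prop26_census2136_kLevel_of_div)
open B6Prop26Census2137KLevelV1 (prop26_census2137_kLevel_of_pairs)
open B6Prop26Census2140KLevelV1 (prop26_census2140_kLevel_of_l2)
open B6Ineq2140GradKLevelCensusV1 (ineq2140_grad_kLevel_census_of_h3 ineq2140_gradT_kLevel_census_of_h3)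

open B6Prop26PrintedKLevelV1 (prop26Printed_kLevel_of_slots)
open B6Prop26DivLegKLevelV1 (prop26_2136_div_kLevel_census)
open B6Cor28HolderUnifKLevelV1 (ineq2137_grad_kLevel_unif)

variable {d ℓ : ℕ} {hd : 1 ≤ d + 1} {hL : Odd (ℓ + 1) ∧ 1 < ℓ + 1} {b₀ b₁ : ℝ}

noncomputable section

open Classical in
/-- **the census2137 slot hm1 — the (2.137)₁ pair majorant of `P_{x,x′}·∇_νG` for the genuine `G`, ONE threshold before the Hölder exponent —
DISCHARGED** from `B6Cor28HolderUnifKLevelV1.ineq2137_grad_kLevel_unif` at `σ := σ₁`, `β := ½`.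
[cite: Balaban1984PropagatorsII, Prop. 2.6 (2.137) p.247, (2.141) p.247] -/
theorem hm1_of_unif (hb₀ : 0 < b₀) (hb₁ : b₀ ≤ b₁) : ∃ (δ M₂ : ℝ) (N₁ : ℕ), 0 < δ ∧ 0 < M₂ ∧ ∀ (α : ℝ), 0 ≤ α → α < 1 → ∃ A : ℝ, 0 ≤ A ∧
      ∀ (m K : ℕ) {Mh k R : ℕ} {P' : Fin (d + 1) → ℕ}
        (hN : ∀ μ, N0 ℓ Mh k P' μ = (PV d ℓ m K hd hL).sitesPerDir 0) (D : TDomains d ℓ Mh k P' R) (hk : k ≤ m + K) (_ : 2 ≤ k)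
        {a : ℕ} (_ : Mh = (ℓ + 1) ^ a) (_ : 8 ≤ Mh) (_ : 2 * (ℓ + 1) ^ 2 ≤ R) (_ : ∀ μ, 5 ≤ P' μ) (_ : 4 ≤ ℓ)
        (_ : ∀ c : ↥(cubes D.toDomains), Placed ℓ k P' c.1) (_ : M₂ ≤ ((ℓ : ℝ) + 1) * Mh) (_ : N₁ + 1 ≤ R * ((ℓ + 1) * Mh))
        {cf : ℝ} (hcf : cf ≠ 0) {w : BondIdx (domT hN D hk) → ℝ} (hw : ∀ i, 0 < w i) (_ : GlobalBand b₀ b₁ cf w)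
        (ν : Fin (d + 1)) (x x' : PBond (PV d ℓ m K hd hL) 0), x.dir = x'.dir →
        supDist x.src x'.src ≤ (ℓ + 1) ^ (blkV1 hN D x).1.1 → supDist x.src x'.src ≤ (ℓ + 1) ^ (blkV1 hN D x').1.1 →
        HasMajorant (g := geomT D) (blkV1 hN D) (pairOp x x' * DV (P := PV d ℓ m K hd hL) ν cf * onFun (GE (domT hN D hk) hcf hw))
          (fun y y' => A * ((((supDist x.src x'.src : ℕ) : ℝ) / (((ℓ + 1 : ℕ) : ℝ)) ^ (blkV1 hN D x).1.1) ^ α *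
            ((geomT D).len y * |cf|⁻¹)) * Real.exp (-(δ * (geomT D).dist y y'))) := by
  obtain ⟨σ₁, hσ₁, h⟩ := ineq2137_grad_kLevel_unif d ℓ hd hL hb₀ hb₁
  obtain ⟨M₂, hM₂, h2⟩ := h σ₁ hσ₁ le_rfl (1 / 2) (by norm_num) (by norm_num)
  refine ⟨delta3 (1 / 2) (2 * σ₁), M₂, 0, delta3_pos (by norm_num) (by positivity), hM₂, fun α hα hα1 => ?_⟩
  obtain ⟨A, hA, h3⟩ := h2 α hα hα1
  refine ⟨A, hA, ?_⟩
  intro m K Mh k R P' hN D hk hk2 a hMha hM8 hR2 hP5 hℓ hpl hM _ cf hcf w hw hwb ν x x' hdir hs1 hs2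
  exact h3 m K hN D hk hk2 hMha hM8 hR2 hP5 hℓ hpl hM hcf hw hwb ν x x' hdir hs1 hs2

open Classical in
/-- **PROPOSITION 2.6 (2.136)–(2.141), VERBATIM (`B6.Prop26Printed`), ON THE GENUINE k-LEVEL V1 FAMILY — SLOTS h3 AND hm1 DISCHARGED**: remaining
displayed inputs hm2, hl3, hl4, hl5, c3, c4 (shapes of `B6Prop26PrintedKLevelV1.prop26Printed_kLevel_of_slots` verbatim).
[cite: Balaban1984PropagatorsII, Prop. 2.6 (2.136)–(2.141) p.247] -/
theorem prop26Printed_kLevel_of_slots5 (hb₀ : 0 < b₀) (hb₁ : b₀ ≤ b₁)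
    (hm2 : ∃ (δ M₂ : ℝ) (N₁ : ℕ), 0 < δ ∧ 0 < M₂ ∧ ∀ (α : ℝ), 0 ≤ α → α < 1 → ∃ A : ℝ, 0 ≤ A ∧
      ∀ (m K : ℕ) {Mh k R : ℕ} {P' : Fin (d + 1) → ℕ}
        (hN : ∀ μ, N0 ℓ Mh k P' μ = (PV d ℓ m K hd hL).sitesPerDir 0) (D : TDomains d ℓ Mh k P' R) (hk : k ≤ m + K) (_ : 2 ≤ k)
        {a : ℕ} (_ : Mh = (ℓ + 1) ^ a) (_ : 8 ≤ Mh) (_ : 2 * (ℓ + 1) ^ 2 ≤ R) (_ : ∀ μ, 5 ≤ P' μ) (_ : 4 ≤ ℓ)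
        (_ : ∀ c : ↥(cubes D.toDomains), Placed ℓ k P' c.1) (_ : M₂ ≤ ((ℓ : ℝ) + 1) * Mh) (_ : N₁ + 1 ≤ R * ((ℓ + 1) * Mh))
        {cf : ℝ} (hcf : cf ≠ 0) {w : BondIdx (domT hN D hk) → ℝ} (hw : ∀ i, 0 < w i) (_ : GlobalBand b₀ b₁ cf w)
        (ν : Fin (d + 1)) (x x' : PBond (PV d ℓ m K hd hL) 0), x.dir = x'.dir →
        supDist x.src x'.src ≤ (ℓ + 1) ^ (blkV1 hN D x).1.1 → supDist x.src x'.src ≤ (ℓ + 1) ^ (blkV1 hN D x').1.1 →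
        HasMajorant (g := geomT D) (blkV1 hN D) (pairOp x x' * onFun (GE (domT hN D hk) hcf hw) * DVa ν cf)
          (fun y y' => A * ((((supDist x.src x'.src : ℕ) : ℝ) / (((ℓ + 1 : ℕ) : ℝ)) ^ (blkV1 hN D x).1.1) ^ α *
            ((geomT D).len y * |cf|⁻¹)) * Real.exp (-(δ * (geomT D).dist y y'))))
    (hl3 : ∃ (δ A M₂ : ℝ) (N₁ : ℕ), 0 < δ ∧ 0 ≤ A ∧ 0 < M₂ ∧
      ∀ (m K : ℕ) {Mh k R : ℕ} {P' : Fin (d + 1) → ℕ}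
        (hN : ∀ μ, N0 ℓ Mh k P' μ = (PV d ℓ m K hd hL).sitesPerDir 0) (D : TDomains d ℓ Mh k P' R) (hk : k ≤ m + K) (_ : 2 ≤ k)
        {a : ℕ} (_ : Mh = (ℓ + 1) ^ a) (_ : 8 ≤ Mh) (_ : 2 * (ℓ + 1) ^ 2 ≤ R) (_ : ∀ μ, 5 ≤ P' μ) (_ : 4 ≤ ℓ)
        (_ : ∀ c : ↥(cubes D.toDomains), Placed ℓ k P' c.1) (_ : M₂ ≤ ((ℓ : ℝ) + 1) * Mh) (_ : N₁ + 1 ≤ R * ((ℓ + 1) * Mh))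
        {cf : ℝ} (hcf : cf ≠ 0) {w : BondIdx (domT hN D hk) → ℝ} (hw : ∀ i, 0 < w i) (_ : GlobalBand b₀ b₁ cf w)
        (ν μ : Fin (d + 1)) (y y' : (geomT D).Site) (ζ J : PBond (PV d ℓ m K hd hL) 0 → ℝ) {s : ℝ} (_ : 0 ≤ s)
        (_ : ∀ x, blkV1 hN D x ≠ y → ζ x = 0) (_ : ∀ x, |ζ x| ≤ s) (_ : ∀ x, blkV1 hN D x ≠ y' → J x = 0),
        ∑ x, (ζ x * (DV ν cf ∘ₗ onFun (GE (domT hN D hk) hcf hw) ∘ₗ DVa μ cf) J x) ^ 2 ≤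
          (A * Real.exp (-(δ * (geomT D).dist y y')) * s) ^ 2 * ∑ x, J x ^ 2)
    (hl4 : ∃ (δ A M₂ : ℝ) (N₁ : ℕ), 0 < δ ∧ 0 ≤ A ∧ 0 < M₂ ∧
      ∀ (m K : ℕ) {Mh k R : ℕ} {P' : Fin (d + 1) → ℕ}
        (hN : ∀ μ, N0 ℓ Mh k P' μ = (PV d ℓ m K hd hL).sitesPerDir 0) (D : TDomains d ℓ Mh k P' R) (hk : k ≤ m + K) (_ : 2 ≤ k)
        {a : ℕ} (_ : Mh = (ℓ + 1) ^ a) (_ : 8 ≤ Mh) (_ : 2 * (ℓ + 1) ^ 2 ≤ R) (_ : ∀ μ, 5 ≤ P' μ) (_ : 4 ≤ ℓ)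
        (_ : ∀ c : ↥(cubes D.toDomains), Placed ℓ k P' c.1) (_ : M₂ ≤ ((ℓ : ℝ) + 1) * Mh) (_ : N₁ + 1 ≤ R * ((ℓ + 1) * Mh))
        {cf : ℝ} (hcf : cf ≠ 0) {w : BondIdx (domT hN D hk) → ℝ} (hw : ∀ i, 0 < w i) (_ : GlobalBand b₀ b₁ cf w)
        (ν μ : Fin (d + 1)) (y y' : (geomT D).Site) (ζ J : PBond (PV d ℓ m K hd hL) 0 → ℝ) {s : ℝ} (_ : 0 ≤ s)
        (_ : ∀ x, blkV1 hN D x ≠ y → ζ x = 0) (_ : ∀ x, |ζ x| ≤ s) (_ : ∀ x, blkV1 hN D x ≠ y' → J x = 0),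
        ∑ x, (ζ x * (DV ν cf ∘ₗ DV μ cf ∘ₗ onFun (GE (domT hN D hk) hcf hw)) J x) ^ 2 ≤
          (A * Real.exp (-(δ * (geomT D).dist y y')) * s) ^ 2 * ∑ x, J x ^ 2)
    (hl5 : ∃ (δ A M₂ : ℝ) (N₁ : ℕ), 0 < δ ∧ 0 ≤ A ∧ 0 < M₂ ∧
      ∀ (m K : ℕ) {Mh k R : ℕ} {P' : Fin (d + 1) → ℕ}
        (hN : ∀ μ, N0 ℓ Mh k P' μ = (PV d ℓ m K hd hL).sitesPerDir 0) (D : TDomains d ℓ Mh k P' R) (hk : k ≤ m + K) (_ : 2 ≤ k)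
        {a : ℕ} (_ : Mh = (ℓ + 1) ^ a) (_ : 8 ≤ Mh) (_ : 2 * (ℓ + 1) ^ 2 ≤ R) (_ : ∀ μ, 5 ≤ P' μ) (_ : 4 ≤ ℓ)
        (_ : ∀ c : ↥(cubes D.toDomains), Placed ℓ k P' c.1) (_ : M₂ ≤ ((ℓ : ℝ) + 1) * Mh) (_ : N₁ + 1 ≤ R * ((ℓ + 1) * Mh))
        {cf : ℝ} (hcf : cf ≠ 0) {w : BondIdx (domT hN D hk) → ℝ} (hw : ∀ i, 0 < w i) (_ : GlobalBand b₀ b₁ cf w)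
        (ν μ : Fin (d + 1)) (y y' : (geomT D).Site) (ζ J : PBond (PV d ℓ m K hd hL) 0 → ℝ) {s : ℝ} (_ : 0 ≤ s)
        (_ : ∀ x, blkV1 hN D x ≠ y → ζ x = 0) (_ : ∀ x, |ζ x| ≤ s) (_ : ∀ x, blkV1 hN D x ≠ y' → J x = 0),
        ∑ x, (ζ x * (onFun (GE (domT hN D hk) hcf hw) ∘ₗ DVa ν cf ∘ₗ DVa μ cf) J x) ^ 2 ≤
          (A * Real.exp (-(δ * (geomT D).dist y y')) * s) ^ 2 * ∑ x, J x ^ 2)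
    (c3 : ∃ M₁ δ₃ : ℝ, ∃ Cε : ℝ → ℝ, 0 < M₁ ∧ 0 < δ₃ ∧ ∀ i : KIdx d ℓ hd hL b₀ b₁, M₁ ≤ (kGeoG i).M →
      ∀ (ε : ℝ) (J : (kGeoG i).Loc) (y y' : (kGeoG i).Site), 0 < ε → ε < 1 → (kGeoG i).suppIn J y' →
        (kG i).e4 J y ≤ Cε ε * Real.exp (-(δ₃ * (kGeoG i).dist y y')) * ((kGeoG i).holder ε J + (kGeoG i).supNorm J))
    (c4 : ∃ M₁ δ₃ : ℝ, ∃ Cαε : ℝ → ℝ → ℝ, 0 < M₁ ∧ 0 < δ₃ ∧ ∀ i : KIdx d ℓ hd hL b₀ b₁, M₁ ≤ (kGeoG i).M →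
      ∀ (α ε : ℝ) (J : (kGeoG i).Loc) (ζ : (kGeoG i).Cut) (y y' : (kGeoG i).Site), 0 ≤ α → 0 < ε → α + ε < 1 →
        (kGeoG i).cutIn ζ y → (kGeoG i).suppIn J y' →
        (kG i).h2 J α ζ ≤ Cαε α ε * ((kGeoG i).len y) ^ (-α) * (kGeoG i).cutH α ζ * Real.exp (-(δ₃ * (kGeoG i).dist y y')) *
          ((kGeoG i).holder (α + ε) J + (kGeoG i).supNorm J)) :
    B6.Prop26Printed (fun i : KIdx d ℓ hd hL b₀ b₁ => kGeoG i) (fun i => kG i) :=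
  prop26Printed_kLevel_of_slots hb₀ hb₁ (prop26_2136_div_kLevel_census d ℓ hd hL hb₀ hb₁) (hm1_of_unif hb₀ hb₁) hm2 hl3 hl4 hl5 c3 c4

end

end Literature.MathematicalPhysics.QuantumFieldTheory.Balaban1983to89.B6Prop26PrintedStage2KLevelV1
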